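import Literature.Analysis.FluidPDE.TaoH1AlmostRegularAssembly
import Literature.Analysis.FluidPDE.ClassicalL2StabilityForced
import HarnessLib

/-!
# Tao 2013, Theorem 5.4 (ii) for `H¹` data WITH FORCING: the uniform `L²`-Cauchy property of
# the approximation scheme

Analysis/FluidPDE proof file (no named facts, no definitions). One brick of the forced twin of
`TaoH1AlmostRegularAssembly.lean` (the discharge chain
`tao2011_smooth_local_existence_forced → tao2011_forced_H1_local_almost_regular`, Tao 2013
Thm. 5.4 (ii) = arXiv Thm. 31 with Lemma 5.5 = Lemma 32 in the inhomogeneous case), the verbatim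
forced twin of `uniform_cauchy_of_stability`:

* `uniform_cauchy_of_stability_forced` — classical solutions of the system with one COMMON force
  on `[0, T]` in Tao's class, with enstrophies `≤ S` and data converging in `L²`, are uniformly
  Cauchy in `C([0,T]; L²)` (the forced `L²` stability estimate `exists_l2_stability_forced`;
  Robinson–Rodrigo–Sadowski 2016, proof of Thm. 6.10, the force cancelling in the difference).

The restart / representative step of the forced assembly is the tree's
`exists_classical_rep_of_restart_forced` / `exists_classical_rep_of_restart_clayForce`
(`TaoH1AlmostRegularForcedRestart.lean`), not repeated here.

## References

* T. Tao, Anal. PDE 6 (2013) 25–107 = arXiv:1108.1165, Thm. 5.4 (ii), (v). [Tao2011]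
* J. C. Robinson, J. L. Rodrigo, W. Sadowski, *The three-dimensional Navier–Stokes equations*,
  CUP 2016, Thm. 6.10 (proof). [RobinsonRodrigoSadowski2016]
-/

noncomputable section

open MeasureTheory TopologicalSpace Set Function Filter ContinuousLinearMap
open _root_.Topology
open scoped InnerProductSpace RealInnerProductSpace ENNReal NNReal Interval

namespace Literature.Analysis.FluidPDE

/-! ## The approximation scheme with a common force: uniform `L²`-Cauchy property -/

section Scheme

variable {ν T : ℝ} {f : ℝ → (EuclideanSpace ℝ (Fin 3)) → (EuclideanSpace ℝ (Fin 3))}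
  {u : ℕ → ℝ → (EuclideanSpace ℝ (Fin 3)) → (EuclideanSpace ℝ (Fin 3))}
  {p : ℕ → ℝ → (EuclideanSpace ℝ (Fin 3)) → ℝ} {u₀ : (EuclideanSpace ℝ (Fin 3)) → (EuclideanSpace ℝ (Fin 3))}

set_option maxHeartbeats 800000 in
/-- **Uniform `L²`-Cauchy property of the forced approximants** from the forced `L²` stability
estimate (`exists_l2_stability_forced`; Robinson–Rodrigo–Sadowski 2016, proof of Thm. 6.10 —
the common force cancels in the difference): classical solutions of the Navier–Stokes system
with one common force `f` (slices in `L²`) on `[0, T]`, in Tao's class, with enstrophies `≤ S`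
and data converging in `L²`, are uniformly Cauchy in `C([0,T]; L²)`. Forced twin of
`uniform_cauchy_of_stability`. [cite: RobinsonRodrigoSadowski2016, Thm. 6.10 (proof)] -/
theorem uniform_cauchy_of_stability_forced (hν : 0 < ν) (hT : 0 < T)
    (hsol : ∀ n, FluidPDE.IsClassicalNSSolutionOn (Icc 0 T) ν f (u n) (p n))
    (hfL2 : ∀ t ∈ Icc 0 T, ∫⁻ x, ‖f t x‖ₑ ^ 2 < ⊤)
    (hu : ∀ n, HasBoundedSobolevNormsOn (Icc 0 T) (u n))
    (hu' : ∀ n, HasBoundedSobolevNormsOn (Icc 0 T) (FluidPDE.timeDerivWithin (Icc 0 T) (u n)))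
    (hp : ∀ n (k : ℕ), ∃ C : ℝ≥0, ∀ t ∈ Icc 0 T, ∫⁻ x, ‖iteratedFDeriv ℝ k (p n t) x‖ₑ ^ 2 ≤ C)
    (hc : ∀ n, FluidPDE.ContinuousInLpOn (Icc 0 T) 2 (u n)) {S : ℝ}
    (hS : ∀ n, ∀ t ∈ Icc 0 T, ∫ x, FluidPDE.frobeniusNormSq (fderiv ℝ (u n t) x) ≤ S)
    (hu₀ : MemLp u₀ 2 volume) (h0 : Tendsto (fun n => eLpNorm (u n 0 - u₀) 2 volume) atTop (𝓝 0)) :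
    ∀ ε : ℝ≥0∞, 0 < ε → ∃ N, ∀ n ≥ N, ∀ m ≥ N, ∀ t ∈ Icc 0 T,
      eLpNorm (u n t - u m t) 2 volume ≤ ε := by
  obtain ⟨Cst, hCst, hstab⟩ := exists_l2_stability_forced
  set e : ℝ := Real.exp (Cst * (ν ^ 3)⁻¹ * S ^ 2 * T) with he
  have h0I : (0 : ℝ) ∈ Icc 0 T := left_mem_Icc.2 hT.le
  -- the stability bound in `ℝ≥0∞`
  set a : ℕ → ℝ≥0∞ := fun n => eLpNorm (u n 0 - u₀) 2 volume with ha
  have hbound : ∀ n m, ∀ t ∈ Icc 0 T, ∫⁻ x, ‖u n t x - u m t x‖ₑ ^ 2 ≤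
      ENNReal.ofReal e * (2 * a n ^ 2 + 2 * a m ^ 2) := by
    intro n m t ht
    have hmem : MemLp (fun x => u n t x - u m t x) 2 volume := ((hc n).1 t ht).sub ((hc m).1 t ht)
    have hmem0 : MemLp (fun x => u n 0 x - u m 0 x) 2 volume := ((hc n).1 0 h0I).sub ((hc m).1 0 h0I)
    have hreal := hstab hν hT (hsol n) (hsol m) hfL2 (hu n) (hu' n) (hp n) (hu m) (hu' m) (hp m)
      (hS m) t ht
    have hexp : Real.exp (Cst * (ν ^ 3)⁻¹ * S ^ 2 * t) ≤ e := by
      rw [he]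
      refine Real.exp_le_exp.2 (mul_le_mul_of_nonneg_left ht.2 ?_)
      have : 0 ≤ (ν ^ 3)⁻¹ := inv_nonneg.2 (pow_nonneg hν.le 3)
      positivity
    have hI0 : 0 ≤ ∫ x, ‖u n 0 x - u m 0 x‖ ^ 2 := integral_nonneg fun _ => sq_nonneg _
    calc ∫⁻ x, ‖u n t x - u m t x‖ₑ ^ 2
        = ENNReal.ofReal (∫ x, ‖u n t x - u m t x‖ ^ 2) := lintegral_enorm_sq_eq_ofReal_integral hmem
      _ ≤ ENNReal.ofReal ((∫ x, ‖u n 0 x - u m 0 x‖ ^ 2) * e) :=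
          ENNReal.ofReal_le_ofReal (hreal.trans (mul_le_mul_of_nonneg_left hexp hI0))
      _ = ENNReal.ofReal e * ∫⁻ x, ‖u n 0 x - u m 0 x‖ₑ ^ 2 := by
          rw [mul_comm, ENNReal.ofReal_mul (Real.exp_pos _).le, lintegral_enorm_sq_eq_ofReal_integral hmem0]
      _ ≤ ENNReal.ofReal e * (2 * a n ^ 2 + 2 * a m ^ 2) := by
          gcongr
          have hsub : ∀ x, u n 0 x - u m 0 x = (u n 0 x - u₀ x) - (u m 0 x - u₀ x) := fun x => by abel
          simp_rw [hsub]
          refine (lintegral_enorm_sq_sub_le (((hc n).1 0 h0I).1.sub hu₀.1)).trans (le_of_eq ?_)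
          rw [ha]; dsimp only
          rw [← FluidPDE.eEnergy_eq_eLpNorm_sq, ← FluidPDE.eEnergy_eq_eLpNorm_sq]
          rfl
  -- the right-hand side tends to zero along `atTop ×ˢ atTop`
  have hF : Tendsto (fun q : ℕ × ℕ => ENNReal.ofReal e * (2 * a q.1 ^ 2 + 2 * a q.2 ^ 2)) atTop (𝓝 0) := by
    have hsq : Tendsto (fun n => a n ^ 2) atTop (𝓝 0) := by
      have h := ((ENNReal.continuous_pow 2).tendsto 0).comp h0
      rw [zero_pow two_ne_zero] at h
      exact h
    have h1 : Tendsto (fun q : ℕ × ℕ => a q.1 ^ 2) atTop (𝓝 0) := by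
      rw [← prod_atTop_atTop_eq]; exact hsq.comp tendsto_fst
    have h2 : Tendsto (fun q : ℕ × ℕ => a q.2 ^ 2) atTop (𝓝 0) := by
      rw [← prod_atTop_atTop_eq]; exact hsq.comp tendsto_snd
    have h3 : Tendsto (fun q : ℕ × ℕ => 2 * a q.1 ^ 2 + 2 * a q.2 ^ 2) atTop (𝓝 (2 * 0 + 2 * 0)) :=
      (ENNReal.Tendsto.const_mul h1 (Or.inr (by simp))).add (ENNReal.Tendsto.const_mul h2 (Or.inr (by simp)))
    rw [mul_zero, add_zero] at h3
    have h4 := ENNReal.Tendsto.const_mul h3 (Or.inr ENNReal.ofReal_ne_top) (a := ENNReal.ofReal e)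
    rwa [mul_zero] at h4
  intro ε hε
  by_cases hεtop : ε = ⊤
  · exact ⟨0, fun n _ m _ t _ => hεtop ▸ le_top⟩
  obtain ⟨N, hN⟩ := ENNReal.tendsto_atTop_zero.1 hF (ε ^ 2) (ENNReal.pow_pos hε 2)
  refine ⟨max N.1 N.2, fun n hn m hm t ht => eLpNorm_two_le_of_lintegral_le_sq ?_⟩
  have hq : N ≤ (n, m) := ⟨(le_max_left _ _).trans hn, (le_max_right _ _).trans hm⟩
  exact (hbound n m t ht).trans (hN (n, m) hq)

end Scheme

end Literature.Analysis.FluidPDE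

end
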